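import Summits.HodgeConjecture.CorCM.CMAlgebraDegreeLeSixNondegenerate
import Summits.HodgeConjecture.CorCM.AndreRiemannBiproducts
import Summits.HodgeConjecture.CorCM.CyclotomicSliceZeta7Closure
import Summits.HodgeConjecture.HodgeConjecture.Theorems.Ring2ClassTargets
import Literature.AlgebraicGeometry.Milne1999.SpecialLefschetzGroupInvariantsCMType
import Literature.AlgebraicGeometry.Pohlmann1968.SimpleCMAbelianVarietyPowersDivisorGenerated
import Literature.AlgebraicGeometry.Pohlmann1968.SimpleCMAbelianVarietyHazamaCriterion
import Literature.AlgebraicGeometry.HodgeTheory.HodgeConjectureAbelianSubquotients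
import HarnessLib

/-!
# Complex abelian varieties of CM type of dimension `≤ 3` are STABLY NONDEGENERATE: every power, and every
# isogeny factor of a power, is divisor-generated — the Hodge conjecture for all of them, unconditionally

COR-CM (cell `pub-hodgecm2`, seat `b16` gen 36, count-neutral claim CM-DIMLE3-STABLE, file 3 of 3; theorems only,
no definition, no named fact).  NEW as stated (an assembly of tree theorems), hence under `Summits/`.

Moonen–Zarhin 1999 (5.2): «for every complex abelian variety `X` of dimension `≤ 3` we have `Hg(X) = Sp_D(V,φ)` and
condition (D) is satisfied» — for `X` of CM type this says that `X` is stably nondegenerate: `dim Hg(X)` is the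
reduced dimension, equivalently (Hazama, Murty; Gordon 1999 Thm. 7.5 with 7.6.1) `B•(Xⁿ) = D•(Xⁿ)` for every
`n ≥ 1` and for every abelian subvariety / quotient / isogeny factor of a power.  The tree had the SIMPLE case
(`Pohlmann1968.isDivisorGenerated_powSucc_of_isSimple_of_isOfCMType_of_dim_le_three`, Ribet 1980 (3.7)) and, with
realisation data in the hypotheses, the product case (`CorCM/CMAlgebraDegreeLeSixNondegenerate`:
simple, pairwise non-isogenous CM abelian varieties of total dimension `≤ 3` form a nondegenerate family).  This file
proves the LITERAL statement for an ARBITRARY complex abelian variety `Y` of CM type (`Milne1999.IsOfCMType`, the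
binder of `HC_CM`) with `dim Y ≤ 3` — products `E × E'`, `E × S`, `E³`-isogenous, `E² × E'`, … included:

* `exists_isIsogeny_biproduct_of_isSimple_of_isOfCMType` — Milne's regrouping `Y → A₁^{r₁} × ⋯ × A_s^{r_s}`
  (Duke 1999 Prop. 1.1) on the tree's carriers, REFINED: an isogeny `Y ⟶ ⨁ᵢ A'_{cls i}` onto a biproduct of copies
  of SIMPLE, PAIRWISE NON-ISOGENOUS CM realisations `(A'_c, ι_c, θ_c)` of CM types `(K_c; Φ_c)`, `cls` surjective
  (so `Σ_c dim A'_c ≤ dim Y`); the construction of `Milne1999.exists_isIsogeny_to_biproduct_of_classes_of_isOfCMType`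
  with the two extra clauses recorded;
* `exists_avDominatedBy_powSucc_biproduct_slots` — every power `Y^{N+1}` is then an isogeny factor
  (`Domination.AVDominatedBy`) of a product `⨁_{j<n} A'_{π j}` of copies of the `A'_c`;
* `isDivisorGenerated_of_avDominatedBy` — `B = D` descends along `s ≫ π = [N]`;
* **`isDivisorGenerated_of_avDominatedBy_powSucc_of_isOfCMType_of_dim_le_three`** (MASTER FORM): for `Y` of CM type
  with `dim Y ≤ 3`, EVERY abelian variety `B` dominated by some power `Y^{N+1}` (every power, everything isogenous to
  a power, every abelian subvariety or quotient of a power, every product tree of such) is divisor-generated;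
  hence **`isDivisorGenerated_powSucc_of_isOfCMType_of_dim_le_three`** (`B•(Y^{N+1}) = D•(Y^{N+1})` for all `N`),
  `hodgeConjectureFor_powSucc_of_isOfCMType_of_dim_le_three` and the isogeny / subvariety / quotient / product-tree
  forms, the exceptional-class form `not_exists_exceptional_of_avDominatedBy_powSucc_of_isOfCMType_of_dim_le_three`,
  the ASK-A conjunction `forall_isDivisorGenerated_and_hodgeConjectureFor_powSucc_of_isOfCMType_of_dim_le_three`,
  and the class-target display `hcOnClass_avDominatedBy_powSucc_isOfCMType_dim_le_three` — all UNCONDITIONAL.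

The bound `3` is sharp for this statement: in dimension `4` the CM abelian varieties `A × E` of Moonen–Zarhin (0.1)
(iv) (`K ⊃ k`, `E` with CM by `k`) and Shioda's / Pohlmann's degenerate simple CM fourfolds carry exceptional
classes (`Pohlmann1968.MumfordSimpleFourfold`, `CorCM/ImaginaryQuadraticTimesCyclicCMHodge`).

## References

* [MoonenZarhin1999LowDim] B. Moonen, Yu. Zarhin, *Hodge classes on abelian varieties of low dimension*, Math. Ann.
  315 (1999) 711–733, (0.1)–(0.2), §5 (5.1)–(5.2), §2 (2.7).
* [Gordon1999HodgeAVSurvey] B. B. Gordon, *A survey of the Hodge conjecture for abelian varieties*, Thm. 6.4, 7.4–7.6.1,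
  10.10.
* [Milne1999LefschetzClasses] J. S. Milne, *Lefschetz classes on abelian varieties*, Duke Math. J. 96 (1999), §1
  Prop. 1.1 (p. 643).
* [Ribet1980] K. A. Ribet, *Division fields of abelian varieties with complex multiplication*, Mém. SMF 2 (1980),
  §3 (3.7).
* [MumfordAV1970] D. Mumford, *Abelian Varieties*, §19 Thm. 1, Cor. 1–2, Remark p. 169.
* [vanGeemen1994HodgeAV] B. van Geemen, *An introduction to the Hodge conjecture for abelian varieties*, §2.4–2.5, §3.6.
-/

noncomputable section

open CategoryTheory CategoryTheory.Limits NumberField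
open scoped BigOperators

namespace Summit.HodgeConjecture.CorCM

open Literature.NumberTheory.ComplexMultiplication
open Literature.AlgebraicGeometry.Motives (AbelianVariety CMType)
open Literature.AlgebraicGeometry.Motives.AbelianVariety
open Literature.AlgebraicGeometry.HodgeTheory
open Literature.AlgebraicGeometry.ComplexMultiplication (IsCMTypeRealisation)
open Literature.AlgebraicGeometry.VanGeemen1994 (hodgeClassSpan)
open Literature.AlgebraicGeometry.Milne1999
open Literature.AlgebraicGeometry.Pohlmann1968
open Literature.Barriers.HodgeConjecture (divisorClassesSpan)
open Summit.HodgeConjecture.CorCM.Domination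
open Summit.HodgeConjecture.CorCM.AndreRiemann
open Summit.HodgeConjecture.HodgeConjecture.Ring2.ClassTargets (HCOnClass)

/-! ## §1 Milne's regrouping, refined: simple, pairwise non-isogenous CM representatives -/

section Regrouping

/-- **Milne's regrouping `A₁^{r₁} × ⋯ × A_s^{r_s} → A` (Duke 1999 Prop. 1.1) with SIMPLE, PAIRWISE NON-ISOGENOUS
representatives**: every complex abelian variety `X` of CM type with `0 < dim X` admits an isogeny
`X ⟶ ⨁ᵢ A'_{cls i}` onto a biproduct of copies of CM REALISATIONS `(A'_c, ι_c, θ_c)` of CM types `(K_c; Φ_c)` of CM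
fields, indexed by a finite type `C` (the isogeny classes of the simple factors), every `A'_c` SIMPLE, `A'_c` and
`A'_{c'}` NOT isogenous for `c ≠ c'`, and `cls` SURJECTIVE (every representative occurs).  Same construction as
`Milne1999.exists_isIsogeny_to_biproduct_of_classes_of_isOfCMType` (Poincaré decomposition into simple CM factors,
a CM-typed model of each simple factor — Deligne 1982 I Prop. 5.1 —, quotient by the isogeny relation,
`Quotient.out` representatives), recording simplicity and non-isogeny instead of `Hom = 0` and commutativity.
[cite: Milne1999LefschetzClasses, §1 Prop. 1.1 (p. 643)] [cite: MumfordAV1970, §19 Thm. 1, Cor. 1 and Cor. 2]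
[cite: Deligne1982HodgeCycles, I Prop. 5.1 and §5 (p. 37)] -/
theorem exists_isIsogeny_biproduct_of_isSimple_of_isOfCMType {X : AbelianVariety ℂ} (hX0 : 0 < X.dim)
    (hCM : IsOfCMType X) :
    ∃ (C : Type) (_ : Fintype C) (K' : C → Type) (_ : ∀ c, Field (K' c)) (_ : ∀ c, NumberField (K' c))
      (_ : ∀ c, IsCMField (K' c)) (Φ' : ∀ c, CMType (K' c)) (A' : C → AbelianVariety ℂ)
      (ι' : ∀ c, 𝓞 (K' c) →+* End (A' c)) (θ' : ∀ c, K' c →+* Module.End ℂ (complexBetti (A' c).X 1))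
      (m : ℕ) (cls : Fin (m + 1) → C) (f : X ⟶ ⨁ fun i => A' (cls i)),
      (∀ c, IsCMTypeRealisation (Φ' c) (A' c) (ι' c) (θ' c)) ∧ (∀ c, (A' c).IsSimple) ∧
      (∀ c c', c ≠ c' → ¬ IsIsogenous (A' c) (A' c')) ∧ Function.Surjective cls ∧ IsIsogeny f := by
  classical
  obtain ⟨m, S, f₀, hS, hf₀⟩ := exists_isIsogeny_to_biproduct_simple_of_isOfCMType hX0 hCM
  -- the isogeny classes of the simple factors
  let r : Setoid (Fin (m + 1)) :=
    { r := fun i j => IsIsogenous (S i) (S j)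
      iseqv :=
        { refl := fun i => IsIsogenous.refl (S i)
          symm := fun h => IsIsogenous.symm' h
          trans := fun h h' => h.trans h' } }
  -- a CM-typed model of every simple factor
  have hmodel : ∀ i : Fin (m + 1), ∃ B : AbelianVariety ℂ, IsCMTyped B ∧ IsIsogenous (S i) B :=
    fun i => exists_isCMTyped_isIsogenous_of_isSimple (S i) (hS i).1 (hS i).2.1 (hS i).2.2
  choose B hBT hSB using hmodel
  have hBdata : ∀ i : Fin (m + 1), ∃ (K : Type) (_ : Field K) (_ : NumberField K) (_ : IsCMField K)
      (Φ : CMType K) (ι : 𝓞 K →+* End (B i)) (θ : K →+* Module.End ℂ (complexBetti (B i).X 1)),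
      IsCMTypeRealisation Φ (B i) ι θ := fun i => by
    obtain @⟨K, _, _, _, Φ, _, ι, θ, h⟩ := hBT i
    exact ⟨K, inferInstance, inferInstance, inferInstance, Φ, ι, θ, h⟩
  choose K iF iN iC Φ ι θ hB using hBdata
  -- classes and representatives
  let C := Quotient r
  let rep : C → Fin (m + 1) := Quotient.out
  have hrep : ∀ i : Fin (m + 1), IsIsogenous (S i) (S (rep (Quotient.mk r i))) := fun i =>
    IsIsogenous.symm' (Quotient.exact (Quotient.out_eq (Quotient.mk r i)) : r.r _ _)
  have hBs : ∀ i, (B i).IsSimple := fun i => (hS i).1.of_isIsogenous (hSB i)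
  refine ⟨C, inferInstance, fun c => K (rep c), fun c => iF (rep c), fun c => iN (rep c), fun c => iC (rep c),
    fun c => Φ (rep c), fun c => B (rep c), fun c => ι (rep c), fun c => θ (rep c), m, fun i => Quotient.mk r i,
    f₀ ≫ biproduct.map fun i => Classical.choose ((hrep i).trans (hSB (rep (Quotient.mk r i)))),
    fun c => hB (rep c), fun c => hBs (rep c), ?_, ?_, ?_⟩
  · -- distinct classes have non-isogenous representatives
    intro c c' hcc' hiso
    refine hcc' ?_
    have h1 : IsIsogenous (S (rep c)) (S (rep c')) :=
      ((hSB (rep c)).trans hiso).trans (IsIsogenous.symm' (hSB (rep c')))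
    calc c = Quotient.mk r (rep c) := (Quotient.out_eq c).symm
      _ = Quotient.mk r (rep c') := Quotient.sound h1
      _ = c' := Quotient.out_eq c'
  · -- every class occurs
    exact fun c => ⟨rep c, Quotient.out_eq c⟩
  · exact isIsogeny_comp hf₀ (isIsogeny_biproduct_map fun i =>
      Classical.choose_spec ((hrep i).trans (hSB (rep (Quotient.mk r i)))))

/-- Bookkeeping: along a SURJECTIVE slot map `cls : J → C`, `Σ_c g c ≤ Σ_j g (cls j)` (every `c` occurs in some
slot; choose a section). [folklore] -/
private theorem sum_le_sum_comp_of_surjective {C J : Type} [Fintype C] [Fintype J] {cls : J → C}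
    (hcls : Function.Surjective cls) (g : C → ℕ) : ∑ c, g c ≤ ∑ j, g (cls j) := by
  classical
  obtain ⟨σ, hσ⟩ := hcls.hasRightInverse
  have hinj : Function.Injective σ := hσ.injective
  calc ∑ c, g c = ∑ c, g (cls (σ c)) := Finset.sum_congr rfl fun c _ => by rw [hσ c]
    _ = ∑ j ∈ Finset.univ.image σ, g (cls j) :=
      (Finset.sum_image (f := fun j => g (cls j)) fun x _ y _ h => hinj h).symm
    _ ≤ ∑ j, g (cls j) :=
      Finset.sum_le_sum_of_subset_of_nonneg (Finset.subset_univ _) fun _ _ _ => Nat.zero_le _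

/-- **The representatives have total dimension at most `dim X`**: `Σ_c dim A'_c ≤ Σ_i dim A'_{cls i} = dim X`
(`cls` surjective; the dimension of a biproduct is the sum, and isogenies preserve dimension) — the reduced
dimension of `X` is at most its dimension. [cite: MumfordAV1970, §19] [cite: Gordon1999HodgeAVSurvey, 7.7] -/
theorem sum_dim_le_dim_of_isIsogeny_biproduct {C : Type} [Fintype C] {A' : C → AbelianVariety ℂ}
    {X : AbelianVariety ℂ} {m : ℕ} {cls : Fin (m + 1) → C} {f : X ⟶ ⨁ fun i => A' (cls i)}
    (hcls : Function.Surjective cls) (hf : IsIsogeny f) : ∑ c, (A' c).dim ≤ X.dim :=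
  calc ∑ c, (A' c).dim ≤ ∑ i, (A' (cls i)).dim := sum_le_sum_comp_of_surjective hcls fun c => (A' c).dim
    _ = (⨁ fun i => A' (cls i)).dim := (dim_biproduct_fin _).symm
    _ = X.dim := (dim_eq_of_isIsogeny hf).symm

end Regrouping

/-! ## §2 Powers are isogeny factors of products of the representatives; `B = D` descends along dominations -/

section Domination

/-- **Every power `X^{N+1}` of an isogeny factor `X` of `⨁ᵢ A'_{cls i}` is an isogeny factor of a product
`⨁_{j<n} A'_{π j}` of copies of the `A'_c`** (`X^{N+2} = X^{N+1} × X`, `Domination.AVDominatedBy.prod`,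
`(⨁ C₁) × (⨁ C₂) ≅ ⨁ (C₁ ⊔ C₂)` re-indexed by `Fin n ⊕ Fin (m+1) ≃ Fin (n+m+1)`). [cite: MumfordAV1970, §19] -/
theorem exists_avDominatedBy_powSucc_biproduct_slots {C : Type} (A' : C → AbelianVariety ℂ) {X : AbelianVariety ℂ}
    {m : ℕ} (cls : Fin (m + 1) → C) (hX : AVDominatedBy X (⨁ fun i => A' (cls i))) :
    ∀ N : ℕ, ∃ (n : ℕ) (π : Fin n → C), AVDominatedBy (X.powSucc N) (⨁ fun j => A' (π j))
  | 0 => ⟨m + 1, cls, hX⟩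
  | N + 1 => by
    classical
    obtain ⟨n, π, hN⟩ := exists_avDominatedBy_powSucc_biproduct_slots A' cls hX N
    let e : Fin (n + (m + 1)) ≃ Fin n ⊕ Fin (m + 1) := finSumFinEquiv.symm
    refine ⟨n + (m + 1), fun j => Sum.elim π cls (e j), ?_⟩
    have h := avDominatedBy_biproduct_reindex e (avDominatedBy_prod_of_biproduct hN hX)
    have hfam : (sumFam (fun j => A' (π j)) fun i => A' (cls i)) ∘ e = fun j => A' (Sum.elim π cls (e j)) := by
      funext j
      simp only [Function.comp_apply]
      rcases e j with a | a <;> rfl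
    rw [hfam] at h
    rw [powSucc_succ]
    exact h

/-- **`B = D` descends along a domination** `s ≫ π = [N]_A`, `N ≠ 0` (`IsDivisorGenerated.of_comp_eq_nsmul_id`:
`N^{2p} c = s^* π^* c` and `π^* c ∈ Bᵖ(P) = Dᵖ(P) ⊗ ℂ`). [cite: vanGeemen1994HodgeAV, §2.4–2.5 and §3.6–3.7]
[cite: MumfordAV1970, §19 Remark p. 169] -/
theorem isDivisorGenerated_of_avDominatedBy {A P : AbelianVariety ℂ} (h : AVDominatedBy A P)
    (hP : IsDivisorGenerated P) : IsDivisorGenerated A := by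
  obtain ⟨s, π, N, hN, hsπ⟩ := h
  exact IsDivisorGenerated.of_comp_eq_nsmul_id s π hN hsπ hP

end Domination

/-! ## §3 CM abelian varieties of dimension `≤ 3`: all powers and all their isogeny factors are divisor-generated -/

section Main

/-- Powers of a zero-dimensional abelian variety are zero-dimensional (`dim (A × B) = dim A + dim B`). [folklore] -/
private theorem dim_powSucc_eq_zero {Y : AbelianVariety ℂ} (h0 : Y.dim = 0) : ∀ N : ℕ, (Y.powSucc N).dim = 0
  | 0 => h0
  | N + 1 => by rw [powSucc_succ, dim_prod, dim_powSucc_eq_zero h0 N, h0]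

/-- **MASTER FORM — complex abelian varieties of CM type of dimension `≤ 3` are stably nondegenerate**
(Moonen–Zarhin 1999 (5.2) for CM varieties, with Gordon 7.5 (3) ⟹ (1) and 7.6.1): for `Y` of CM type
(`Milne1999.IsOfCMType Y`) with `dim Y ≤ 3`, every complex abelian variety `B` DOMINATED by a power `Y^{N+1}`
(`s ≫ π = [M]_B`, `M ≠ 0`: every power, everything isogenous to a power, every abelian subvariety and every quotient
of a power, every product of such) is divisor-generated, `B•(B) = D•(B)`.  Proof: `dim Y = 0` — then `dim Y^{N+1} = 0`
and `B = D` there trivially; else regroup `Y ∼ ⨁ᵢ A'_{cls i}` with simple, pairwise non-isogenous CM representatives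
of total dimension `≤ dim Y ≤ 3` (§1), which form a NONDEGENERATE family
(`isNondegenerateFamily_of_isSimple_of_pairwise_not_isIsogenous_of_sum_dim_le_three`: Ribet's bound in degree `≤ 6`,
the `(2,4)` and all-quadratic cases), so `B = D` on every `⨁_j A'_{π j}`
(`hodgeClassSpan_prod_eq_divisorClassesSpan_…`); `B ⊑ Y^{N+1} ⊑ ⨁_j A'_{π j}` (§2) and `B = D` descends.
UNCONDITIONAL. [cite: MoonenZarhin1999LowDim, §5 (5.1)–(5.2)] [cite: Gordon1999HodgeAVSurvey, 7.5 and 7.6.1]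
[cite: Ribet1980, §3 (3.7)] [cite: Milne1999LefschetzClasses, §1 Prop. 1.1] -/
theorem isDivisorGenerated_of_avDominatedBy_powSucc_of_isOfCMType_of_dim_le_three {Y B : AbelianVariety ℂ}
    (hcm : IsOfCMType Y) (h3 : Y.dim ≤ 3) {N : ℕ} (hB : AVDominatedBy B (Y.powSucc N)) :
    IsDivisorGenerated B := by
  classical
  rcases Nat.eq_zero_or_pos Y.dim with h0 | h0
  · exact isDivisorGenerated_of_avDominatedBy hB (isDivisorGenerated_of_dim_eq_zero _ (dim_powSucc_eq_zero h0 N))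
  · obtain ⟨C, _, K', _, _, _, Φ', A', ι', θ', m, cls, f, hA, hs, hniso, hcls, hf⟩ :=
      exists_isIsogeny_biproduct_of_isSimple_of_isOfCMType h0 hcm
    haveI : Nonempty C := ⟨cls 0⟩
    have hsum : ∑ c, (A' c).dim ≤ 3 := (sum_dim_le_dim_of_isIsogeny_biproduct hcls hf).trans h3
    obtain ⟨n, π, hdom⟩ :=
      exists_avDominatedBy_powSucc_biproduct_slots A' cls (AVDominatedBy.of_isIsogeny_hom hf (AVDominatedBy.refl _)) N
    refine isDivisorGenerated_of_avDominatedBy (hB.trans hdom) fun p c hcQ hcH => ?_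
    rw [← hodgeClassSpan_prod_eq_divisorClassesSpan_of_isSimple_of_pairwise_not_isIsogenous_of_sum_dim_le_three
      hA hs hniso hsum π p]
    exact Submodule.subset_span ⟨hcQ, hcH⟩

variable {Y : AbelianVariety ℂ}

/-- **`B•(Y^{N+1}) = D•(Y^{N+1})` for every power of a complex abelian variety `Y` of CM type with `dim Y ≤ 3`**
(Moonen–Zarhin (5.2), CM case, all powers: products of CM elliptic curves, CM elliptic curve × simple CM surface,
simple CM threefolds, … and all their powers). UNCONDITIONAL. [cite: MoonenZarhin1999LowDim, §5 (5.2)]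
[cite: Gordon1999HodgeAVSurvey, 7.5] -/
theorem isDivisorGenerated_powSucc_of_isOfCMType_of_dim_le_three (hcm : IsOfCMType Y) (h3 : Y.dim ≤ 3) (N : ℕ) :
    IsDivisorGenerated (Y.powSucc N) :=
  isDivisorGenerated_of_avDominatedBy_powSucc_of_isOfCMType_of_dim_le_three hcm h3 (AVDominatedBy.refl _)

/-- **`B•(Y) = D•(Y)` for every complex abelian variety of CM type of dimension `≤ 3`** (`N = 0`).
[cite: MoonenZarhin1999LowDim, §5 (5.2) and (0.2)] -/
theorem isDivisorGenerated_of_isOfCMType_of_dim_le_three (hcm : IsOfCMType Y) (h3 : Y.dim ≤ 3) :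
    IsDivisorGenerated Y :=
  isDivisorGenerated_powSucc_of_isOfCMType_of_dim_le_three hcm h3 0

/-- **`B = D` for everything isogenous to a power of a CM abelian variety of dimension `≤ 3`.**
[cite: MoonenZarhin1999LowDim, §5 (5.2)] [cite: vanGeemen1994HodgeAV, §2.4–2.5 and §3.6] -/
theorem isDivisorGenerated_of_isIsogenous_powSucc_of_isOfCMType_of_dim_le_three {B : AbelianVariety ℂ} {N : ℕ}
    (hcm : IsOfCMType Y) (h3 : Y.dim ≤ 3) (h : IsIsogenous B (Y.powSucc N)) : IsDivisorGenerated B :=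
  isDivisorGenerated_of_avDominatedBy_powSucc_of_isOfCMType_of_dim_le_three hcm h3
    (AVDominatedBy.of_isIsogenous h (AVDominatedBy.refl _))

/-- **`B = D` for every abelian subvariety of a power** of a CM abelian variety of dimension `≤ 3` (Gordon 7.6.1:
«an abelian subvariety of a stably nondegenerate abelian variety is stably nondegenerate»).
[cite: Gordon1999HodgeAVSurvey, 7.6.1] [cite: MumfordAV1970, §19 Thm. 1] -/
theorem isDivisorGenerated_of_isClosedImmersion_powSucc_of_isOfCMType_of_dim_le_three {B : AbelianVariety ℂ}
    {N : ℕ} (hcm : IsOfCMType Y) (h3 : Y.dim ≤ 3) (ι : B ⟶ Y.powSucc N)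
    [_root_.AlgebraicGeometry.IsClosedImmersion (Hom.toSchemeHom ι)] : IsDivisorGenerated B :=
  IsDivisorGenerated.of_isClosedImmersion ι (isDivisorGenerated_powSucc_of_isOfCMType_of_dim_le_three hcm h3 N)

/-- **`B = D` for every quotient of a power** of a CM abelian variety of dimension `≤ 3`.
[cite: Gordon1999HodgeAVSurvey, 7.6.1] [cite: MumfordAV1970, §19 Thm. 1 and Remark p. 169] -/
theorem isDivisorGenerated_of_surjective_hom_powSucc_of_isOfCMType_of_dim_le_three {B : AbelianVariety ℂ}
    {N : ℕ} (hcm : IsOfCMType Y) (h3 : Y.dim ≤ 3) (q : Y.powSucc N ⟶ B)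
    [_root_.AlgebraicGeometry.Surjective (Hom.toSchemeHom q)] : IsDivisorGenerated B :=
  IsDivisorGenerated.of_surjective_hom q (isDivisorGenerated_powSucc_of_isOfCMType_of_dim_le_three hcm h3 N)

/-- **`B = D` for every product tree of isogeny factors** of a CM abelian variety `Y` of dimension `≤ 3` (all
`∏_k B_k^{n_k}` with each `B_k` an abelian subvariety, quotient or isogeny factor of `Y`): such a `P` is an isogeny
factor of a power of `Y` (`CyclotomicSlice.exists_avDominatedBy_powSucc_of_isProductOf`).
[cite: Gordon1999HodgeAVSurvey, 7.5 and 7.6.1] [cite: MumfordAV1970, §19] -/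
theorem isDivisorGenerated_of_isProductOf_avDominatedBy_of_isOfCMType_of_dim_le_three {P : AbelianVariety ℂ}
    (hcm : IsOfCMType Y) (h3 : Y.dim ≤ 3) (hP : IsProductOf (fun B => AVDominatedBy B Y) P) :
    IsDivisorGenerated P := by
  obtain ⟨N, hN⟩ := CyclotomicSlice.exists_avDominatedBy_powSucc_of_isProductOf hP
  exact isDivisorGenerated_of_avDominatedBy_powSucc_of_isOfCMType_of_dim_le_three hcm h3 hN

/-- **No power of a CM abelian variety of dimension `≤ 3`, and no isogeny factor of one, supports an exotic
(exceptional) Hodge class** (Milne 1999 Prop. 4.8 (a) for these `Y`). [cite: MoonenZarhin1999LowDim, §5 (5.2) and (0.1)–(0.2)]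
[cite: Milne1999LefschetzClasses, Prop. 4.8] -/
theorem not_exists_exceptional_of_avDominatedBy_powSucc_of_isOfCMType_of_dim_le_three {B : AbelianVariety ℂ}
    {N : ℕ} (hcm : IsOfCMType Y) (h3 : Y.dim ≤ 3) (hB : AVDominatedBy B (Y.powSucc N)) :
    ¬∃ (p : ℕ) (c : complexBetti B.X (2 * p)), IsRationalClass c ∧ IsOfHodgeType B.dim B.X (2 * p) p p c ∧
        c ∉ divisorClassesSpan B.X B.dim p := by
  rintro ⟨p, c, hcQ, hcH, hcD⟩
  exact hcD (isDivisorGenerated_of_avDominatedBy_powSucc_of_isOfCMType_of_dim_le_three hcm h3 hB p c hcQ hcH)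

/-- **The Hodge conjecture for every power `Y^{N+1}` of a complex abelian variety of CM type of dimension `≤ 3`**
(dimension `(N+1)·dim Y`, unbounded), UNCONDITIONAL (`B = D` + Lefschetz `(1,1)` + cup products of divisors
algebraic). [cite: MoonenZarhin1999LowDim, §5 (5.2)] [cite: Gordon1999HodgeAVSurvey, 10.10] [cite: Deligne2000, §1] -/
theorem hodgeConjectureFor_powSucc_of_isOfCMType_of_dim_le_three (hcm : IsOfCMType Y) (h3 : Y.dim ≤ 3) (N : ℕ) :
    HodgeConjectureFor (Y.powSucc N).dim (Y.powSucc N).X :=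
  hodgeConjectureFor_of_isDivisorGenerated _ (isDivisorGenerated_powSucc_of_isOfCMType_of_dim_le_three hcm h3 N)

/-- **The Hodge conjecture for every abelian variety dominated by (in particular: isogenous to, an abelian
subvariety of, a quotient of) a power of a CM abelian variety of dimension `≤ 3`**, UNCONDITIONAL.
[cite: MoonenZarhin1999LowDim, §5 (5.2)] [cite: vanGeemen1994HodgeAV, Lemma 3.7] [cite: Deligne2000, §1] -/
theorem hodgeConjectureFor_of_avDominatedBy_powSucc_of_isOfCMType_of_dim_le_three {B : AbelianVariety ℂ} {N : ℕ}
    (hcm : IsOfCMType Y) (h3 : Y.dim ≤ 3) (hB : AVDominatedBy B (Y.powSucc N)) : HodgeConjectureFor B.dim B.X :=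
  hodgeConjectureFor_of_isDivisorGenerated _
    (isDivisorGenerated_of_avDominatedBy_powSucc_of_isOfCMType_of_dim_le_three hcm h3 hB)

/-- **The Hodge conjecture for everything isogenous to a power** of a CM abelian variety of dimension `≤ 3`.
[cite: MoonenZarhin1999LowDim, §5 (5.2)] [cite: vanGeemen1994HodgeAV, Lemma 3.7] [cite: Deligne2000, §1] -/
theorem hodgeConjectureFor_of_isIsogenous_powSucc_of_isOfCMType_of_dim_le_three {B : AbelianVariety ℂ} {N : ℕ}
    (hcm : IsOfCMType Y) (h3 : Y.dim ≤ 3) (h : IsIsogenous B (Y.powSucc N)) : HodgeConjectureFor B.dim B.X :=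
  hodgeConjectureFor_of_isDivisorGenerated _
    (isDivisorGenerated_of_isIsogenous_powSucc_of_isOfCMType_of_dim_le_three hcm h3 h)

/-- **The Hodge conjecture for every product tree of isogeny factors** of a CM abelian variety of dimension `≤ 3`.
[cite: Gordon1999HodgeAVSurvey, 7.5, 7.6.1 and 10.10] [cite: Deligne2000, §1] -/
theorem hodgeConjectureFor_of_isProductOf_avDominatedBy_of_isOfCMType_of_dim_le_three {P : AbelianVariety ℂ}
    (hcm : IsOfCMType Y) (h3 : Y.dim ≤ 3) (hP : IsProductOf (fun B => AVDominatedBy B Y) P) :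
    HodgeConjectureFor P.dim P.X :=
  hodgeConjectureFor_of_isDivisorGenerated _
    (isDivisorGenerated_of_isProductOf_avDominatedBy_of_isOfCMType_of_dim_le_three hcm h3 hP)

/-- **ASK-A as filed**: for every complex abelian variety `Y` of CM type of dimension `≤ 3` and every `N`,
`Y^{N+1}` is divisor-generated AND satisfies the Hodge conjecture. UNCONDITIONAL.
[cite: MoonenZarhin1999LowDim, §5 (5.2)] [cite: Gordon1999HodgeAVSurvey, 7.5 and 10.10] -/
theorem forall_isDivisorGenerated_and_hodgeConjectureFor_powSucc_of_isOfCMType_of_dim_le_three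
    (hcm : IsOfCMType Y) (h3 : Y.dim ≤ 3) :
    ∀ N : ℕ, IsDivisorGenerated (Y.powSucc N) ∧ HodgeConjectureFor (Y.powSucc N).dim (Y.powSucc N).X :=
  fun N => ⟨isDivisorGenerated_powSucc_of_isOfCMType_of_dim_le_three hcm h3 N,
    hodgeConjectureFor_powSucc_of_isOfCMType_of_dim_le_three hcm h3 N⟩

/-- **Class-target display** (`Ring2.ClassTargets.HCOnClass`): the Hodge conjecture holds on the class of complex
abelian varieties dominated by a power of a CM abelian variety of dimension `≤ 3`. UNCONDITIONAL.
[cite: MoonenZarhin1999LowDim, §5 (5.2)] [cite: Deligne2000, §1] -/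
theorem hcOnClass_avDominatedBy_powSucc_isOfCMType_dim_le_three :
    HCOnClass fun A => ∃ (Y : AbelianVariety ℂ) (N : ℕ), IsOfCMType Y ∧ Y.dim ≤ 3 ∧ AVDominatedBy A (Y.powSucc N) :=
  fun _ ⟨_, _, hcm, h3, hA⟩ => hodgeConjectureFor_of_avDominatedBy_powSucc_of_isOfCMType_of_dim_le_three hcm h3 hA

/-- **Class-target display, plain form**: the Hodge conjecture on the class of powers-up-to-isogeny of CM abelian
varieties of dimension `≤ 3`. [cite: MoonenZarhin1999LowDim, §5 (5.2)] [cite: Deligne2000, §1] -/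
theorem hcOnClass_isIsogenous_powSucc_isOfCMType_dim_le_three :
    HCOnClass fun A => ∃ (Y : AbelianVariety ℂ) (N : ℕ), IsOfCMType Y ∧ Y.dim ≤ 3 ∧ IsIsogenous A (Y.powSucc N) :=
  fun _ ⟨_, _, hcm, h3, hA⟩ => hodgeConjectureFor_of_isIsogenous_powSucc_of_isOfCMType_of_dim_le_three hcm h3 hA

end Main

end Summit.HodgeConjecture.CorCM

end
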